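import Summits.BirchSwinnertonDyer.BirchSwinnertonDyer.Theorems.AlignedTransportAtTwoMainConjectureOfRankZeroBSDAtTwoTwoFixedPointLemma
import HarnessLib

/-!
# Route `AlignedTransportAtTwo`, crux C2 `MainConjectureOfRankZeroBSDAtTwo` (stmt-BirchSwinnertonDyer-22298):
# THE TWO-FIXED-POINTS LEMMA AT `p = 2`, ROOT-FREE (part 2) — `[T¹]v ≡ λ(L) (mod 2)`, `λ(L) + ord₀ L + ord₋₂ L` EVEN,
# and `v(−2) = (−1)^{λ(L)}·v(0)` for every non-zero `L ∈ ℤ₂⟦T⟧` with `L(T^ι) = v·L`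

HONEST FRAMING (cell `bsd-f1-sign2`, WIDTH-5 attached prover seat `bsd-line-att-p5` gen 33 on line `birth` of the lead
`bsd-line-att-p2`; `--supports` stmt-BirchSwinnertonDyer-22298, closes nothing; BSD is NOT proved by any of this; the crux C2, its
verdict «blocked-on `Rank1Residual.GreenbergMuConjectureIrreducible`» and every registered stub are untouched). PURE COMMUTATIVE
ALGEBRA over `Λ = ℤ₂⟦T⟧` — THEOREMS ONLY (no `def`, no named fact, no `sorry`). Continuation of
`…MainConjectureOfRankZeroBSDAtTwoTwoFixedPointLemma` (§1–§6 there: `ι + 2 = (T+2)(1+ι)`, S64w `(T+2) ∣ f ↔ f(−2) = 0`, S64e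
`f(T^ι)(−2) = f(−2)`, orders at the two fixed points, S64u `(−1)^{ord₀ L} = v(0)`, S64v `(−1)^{ord₋₂ L} = v(−2)`); here:

* §7 **`v(0) ≡ 1` and `[T¹] v ≡ λ(L) (mod 2)`** for every non-zero `L` with `L(T^ι) = v·L` — reduce the functional equation of the
  `2`-free part `L₀ = L/2^{μ}` modulo `2`: in `𝔽₂⟦T⟧` (a domain with `2 = 0`), `L̄₀ = T^λ·G` with `G₀ ≠ 0`, `ι = T·(1+ι)` (as `−1 = 1`),
  so `L̄₀(T^ι) = T^λ(1+ι)^λ G(T^ι)`; cancel `T^λ` and compare the coefficients of `T⁰`, `T¹`: `G₀ = v̄₀G₀`, `G₁ + λG₀ = v̄₀G₁ + v̄₁G₀`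
  (`constantCoeff_eq_one_and_coeff_one_eq_order_of_subst_eq_mul`, stated over any domain `k` with `2 = 0`);
* §8 **S64t, THE TWO-FIXED-POINTS LEMMA**: with `v(0) = (−1)^m`, `v(−2) = (−1)^n` (part 1) and `v(−2) = v₀ − 2v₁ + 4r`:
  `(−1)^n ≡ (−1)^m − 2λ (mod 4)`, whence **`λ(L) + m + n` is even** (`even_lam_add_orderAtZero_add_orderAtNegTwo`; in the
  planner-of-record's binder shape: `twoFixedPointLemma`), **`v(−2) = (−1)^{λ(L)}·v(0)`** for every non-zero `L`
  (`evalAt_negTwo_eq_neg_one_pow_lam_mul_constantCoeff`), `v ∈ Λ^×`, the road's shape «`L(0) ≠ 0 ⇒ λ(L) ≡ ord₋₂ L (mod 2)`», and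
  the `λ = 1` dichotomy «`(T+2) ∣ L`, `λ(L)` odd ⇒ `λ(L) ≥ 3` unless `L/2^μ = (T+2)·unit`» (`three_le_lam_or_of_odd_lam`).
  No Weierstrass preparation, no roots in `ℂ₂`, no `μ = 0` hypothesis. At odd `p` the same bookkeeping only gives `λ ≡ ord₀`;
  `T = −2` is in the open disc only at `p = 2` (Greenberg, LNM 1716, p. 181). This proves the support `TwoFixedPointLemma` (S64t)
  of the cell's D-imc-64 (MEMO-imc §10.103, -imc g23; HOME `MEMO-imc-data/dimc64/lean/Sketch66.lean`), whose kernel-checked glue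
  `lambdaTwoFixedPoints_of_twoFixedPointLemma` yields `LambdaTwoFixedPointsLawAtTwo` (K64λ) for Sprung's `♯/♭` pair; and, for the
  printed multiplier `w(1+T)^c` of an ordinary curve, it refines the tree's PARITY(2) law `(−1)^λ = χ₈(N_E)`
  (`even_firstUnitCoeff_iff_conductorNorm_mod_eight`) to `(−1)^{ord₋₂ L₂(E,T)} = w(E)·χ₈(N_E) = w(E ⊗ χ₈)` (companion file
  `…RoadSecondFixedPoint`, the att-p5 road's «`(T+2) ∣ L₂`, `λ₂` odd», crux memo CHI8-TWIST-att-p5-g32 §2).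

References: R. Greenberg, LNM 1716 (1999), §1 pp. 67–68, §5 p. 181 [GreenbergLNM1716]; L. Washington, GTM 83, §7.1 [Washington1997].
-/

set_option linter.dupNamespace false
set_option autoImplicit false

noncomputable section

open scoped Classical

namespace Summit.BirchSwinnertonDyer.BirchSwinnertonDyer.Theorems.AlignedTransportAtTwoTwoFixedPoints

open PowerSeries Literature.NumberTheory.EllipticCurves Literature.Barriers.BirchSwinnertonDyer
  Summit.BirchSwinnertonDyer.Rank1Residual.Supersingular
  Summit.BirchSwinnertonDyer.Rank1Residual.F1Sign2 Summit.BirchSwinnertonDyer.Rank1Residual.X1.MuLambda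

/-! ## §7 Reduction modulo `2`: the `T`-coefficient of the multiplier is `λ(L) (mod 2)` -/

/-- `[T¹](φ·ψ) = φ₀ψ₁ + φ₁ψ₀`. [folklore] -/
theorem coeff_one_mul' {R : Type*} [CommRing R] (φ ψ : PowerSeries R) :
    coeff 1 (φ * ψ) = constantCoeff φ * coeff 1 ψ + coeff 1 φ * constantCoeff ψ := by
  rw [PowerSeries.coeff_mul, Finset.Nat.sum_antidiagonal_eq_sum_range_succ_mk, Finset.sum_range_succ,
    Finset.sum_range_succ, Finset.sum_range_zero]
  simp

/-- `[T¹](h^n) = n·h₁` when `h(0) = 1`. [folklore] -/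
theorem coeff_one_pow_of_constantCoeff_eq_one {R : Type*} [CommRing R] {h : PowerSeries R}
    (h0 : constantCoeff h = 1) (n : ℕ) : coeff 1 (h ^ n) = n * coeff 1 h := by
  induction n with
  | zero => simp
  | succ n ih =>
    rw [pow_succ, coeff_one_mul', ih, map_pow, h0, one_pow]
    push_cast
    ring

/-- `[T¹] f(g(T)) = f₁·g₁` when `g(0) = 0`. [folklore] -/
theorem coeff_one_subst_of_constantCoeff_eq_zero {R : Type*} [CommRing R] {f g : PowerSeries R}
    (hg : constantCoeff g = 0) : coeff 1 (f.subst g) = coeff 1 f * coeff 1 g := by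
  rw [coeff_subst' (HasSubst.of_constantCoeff_zero' hg), finsum_eq_single _ 1]
  · rw [pow_one, smul_eq_mul]
  · intro d hd
    rcases Nat.lt_or_gt_of_ne hd with h | h
    · obtain rfl : d = 0 := by omega
      simp
    · rw [PowerSeries.coeff_of_lt_order 1 (lt_of_lt_of_le (by exact_mod_cast h) (natCast_le_order_pow hg d)),
        smul_zero]

/-- `ι` has integer coefficients: it is fixed by every change of scalars. [folklore] -/
theorem map_invOnePlusSubOne {R S : Type*} [CommRing R] [CommRing S] (φ : R →+* S) :
    PowerSeries.map φ (invOnePlusSubOne : PowerSeries R) = invOnePlusSubOne := by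
  ext n
  rw [PowerSeries.coeff_map, coeff_invOnePlusSubOne, coeff_invOnePlusSubOne]
  split_ifs <;> simp

/-- **The `T`-coefficient of the multiplier in characteristic `2`.** Over a domain `k` with `2 = 0`: if `F ≠ 0` in `k⟦T⟧` and
`F(T^ι) = u·F`, then `u(0) = 1` and **`[T¹] u = ord_T F`** (as an element of `k`). Proof: `F = T^n·G`, `G(0) ≠ 0`;
`ι = T·(1 + ι)` in characteristic `2`, so `F(T^ι) = T^n (1+ι)^n G(T^ι)`; cancel `T^n` and compare the coefficients of `T⁰`
and `T¹`: `G₀ = u₀G₀` and `G₁ + n·G₀ = u₀G₁ + u₁G₀` (`[T¹](1+ι)^n = n·ι₁ = n`, `[T¹]G(T^ι) = G₁ι₁ = G₁` since `−1 = 1`).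
This is the formal shadow, one coefficient beyond Greenberg's sign comparison, of the second fixed point `T = −2`
(cf. the tree's `norm_natCast_sub_le_of_subst_invOnePlusSubOne_eq` for the multiplier `σ(1+T)^c`). [cite: GreenbergLNM1716, §5 p. 181] -/
theorem constantCoeff_eq_one_and_coeff_one_eq_order_of_subst_eq_mul {k : Type*} [CommRing k] [IsDomain k]
    (h2 : (2 : k) = 0) {F u : PowerSeries k} (hF : F ≠ 0)
    (hFE : F.subst (invOnePlusSubOne : PowerSeries k) = u * F) :
    constantCoeff u = 1 ∧ coeff 1 u = (F.order.toNat : k) := by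
  set n : ℕ := F.order.toNat with hn
  set G : PowerSeries k := divXPowOrder F with hG
  set j : PowerSeries k := invOnePlusSubOne with hj
  have hm1 : (-1 : k) = 1 := by linear_combination -h2
  have hnegX : (-X : PowerSeries k) = X := by
    rw [neg_eq_neg_one_mul, show (-1 : PowerSeries k) = 1 from by
      rw [← map_one (C (R := k)), ← map_neg, hm1], one_mul]
  have hFG : F = X ^ n * G := (X_pow_order_mul_divXPowOrder (f := F)).symm
  have hG0 : constantCoeff G ≠ 0 := by
    rw [hG, Ne, constantCoeff_divXPowOrder_eq_zero_iff]; exact hF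
  have hj0 : constantCoeff j = 0 := constantCoeff_invOnePlusSubOne
  have hj1 : coeff 1 j = 1 := by rw [hj, coeff_one_invOnePlusSubOne, hm1]
  have hj10 : constantCoeff (j + 1) = 1 := by rw [map_add, hj0, map_one, zero_add]
  have hjX : j = X * (j + 1) := by
    have h := invOnePlusSubOne_eq_neg_X_mul (R := k)
    rw [hnegX] at h
    exact h
  have hsub : F.subst j = X ^ n * ((j + 1) ^ n * G.subst j) := by
    rw [hFG, subst_mul hasSubst_invOnePlusSubOne, subst_pow hasSubst_invOnePlusSubOne,
      subst_X hasSubst_invOnePlusSubOne, ← hj]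
    have hjn : j ^ n = X ^ n * (j + 1) ^ n := by
      conv_lhs => rw [hjX]
      rw [mul_pow]
    rw [hjn, mul_assoc]
  have hXn : ((X : PowerSeries k) ^ n) ≠ 0 := pow_ne_zero _ X_ne_zero
  have hcancel : (j + 1) ^ n * G.subst j = u * G := by
    apply mul_left_cancel₀ hXn
    rw [← hsub, hFE, hFG]; ring
  -- constant coefficients
  have hu0 : constantCoeff u = 1 := by
    have h := congrArg constantCoeff hcancel
    rw [map_mul, map_mul, map_pow, hj10, one_pow, one_mul,
      Literature.Barriers.BirchSwinnertonDyer.constantCoeff_subst_of_constantCoeff_eq_zero hj0] at h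
    have h' : constantCoeff G * (constantCoeff u - 1) = 0 := by linear_combination -h
    rcases mul_eq_zero.mp h' with h'' | h''
    · exact absurd h'' hG0
    · linear_combination h''
  refine ⟨hu0, ?_⟩
  -- coefficients of `T`
  have h1 : coeff 1 ((j + 1) ^ n * G.subst j) = coeff 1 (u * G) := by rw [hcancel]
  rw [coeff_one_mul', coeff_one_mul', map_pow, hj10, one_pow, one_mul, coeff_one_pow_of_constantCoeff_eq_one hj10 n,
    map_add, hj1, PowerSeries.coeff_one, if_neg one_ne_zero, add_zero, mul_one,
    coeff_one_subst_of_constantCoeff_eq_zero hj0, hj1, mul_one,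
    Literature.Barriers.BirchSwinnertonDyer.constantCoeff_subst_of_constantCoeff_eq_zero hj0, hu0, one_mul] at h1
  -- h1 : G₁ + n·G₀ = G₁ + u₁·G₀
  have h' : constantCoeff G * (coeff 1 u - n) = 0 := by linear_combination -h1
  rcases mul_eq_zero.mp h' with h'' | h''
  · exact absurd h'' hG0
  · linear_combination h''

/-- The functional equation descends to the `2`-free part: `L₀(T^ι) = v·L₀` for `L = 2^{μ}·L₀`. [folklore] -/
theorem subst_pfree_eq_mul {L v : PowerSeries ℤ_[2]} (hFE : L.subst (invOnePlusSubOne : PowerSeries ℤ_[2]) = v * L) :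
    (pfree L).subst (invOnePlusSubOne : PowerSeries ℤ_[2]) = v * pfree L := by
  have hfac := eq_C_pow_mu_mul_pfree (p := 2) L
  have hC : (C (((2 : ℕ) : ℤ_[2]) ^ mu L) : PowerSeries ℤ_[2]) ≠ 0 := C_pow_ne_zero (p := 2) (mu L)
  apply mul_left_cancel₀ hC
  have h := hFE
  rw [hfac, subst_mul hasSubst_invOnePlusSubOne, subst_invOnePlusSubOne_C] at h
  rw [h]; ring

/-- **`v(0) ≡ 1` and `[T¹] v ≡ λ(L) (mod 2)`** for every non-zero `L ∈ ℤ₂⟦T⟧` with `L(T^ι) = v·L` (reduce the functional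
equation of the `2`-free part of `L` modulo `2` and apply the characteristic-`2` computation). [cite: GreenbergLNM1716, §5 p. 181] -/
theorem residue_constantCoeff_and_coeff_one {L v : PowerSeries ℤ_[2]} (hL : L ≠ 0) (hFE : L.subst (invOnePlusSubOne : PowerSeries ℤ_[2]) = v * L) :
    IsLocalRing.residue ℤ_[2] (constantCoeff v) = 1 ∧
      IsLocalRing.residue ℤ_[2] (coeff 1 v) = (lam L : IsLocalRing.ResidueField ℤ_[2]) := by
  have h0 := subst_pfree_eq_mul hFE
  have hred : red (pfree L) ≠ 0 := red_pfree_ne_zero hL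
  -- reduce modulo `2`
  have hFEk : (red (pfree L)).subst (invOnePlusSubOne : PowerSeries (IsLocalRing.ResidueField ℤ_[2])) =
      red v * red (pfree L) := by
    have h := congrArg (PowerSeries.map (IsLocalRing.residue ℤ_[2])) h0
    rw [map_mul] at h
    rw [red, red, ← h, ← map_invOnePlusSubOne (IsLocalRing.residue ℤ_[2])]
    exact (PowerSeries.map_subst hasSubst_invOnePlusSubOne (h := IsLocalRing.residue ℤ_[2]) (pfree L)).symm
  -- `2 = 0` in `𝔽₂` (also the tree's `ManinLocalTwoThree.two_eq_zero_residueField_padicInt`, not imported here)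
  have h2 : (2 : IsLocalRing.ResidueField ℤ_[2]) = 0 := by
    have h : IsLocalRing.residue ℤ_[2] (2 : ℤ_[2]) = 0 := by
      rw [IsLocalRing.residue_eq_zero_iff, PadicInt.maximalIdeal_eq_span_p, Ideal.mem_span_singleton]
      exact ⟨1, by norm_num⟩
    rwa [map_ofNat] at h
  obtain ⟨hc0, hc1⟩ := constantCoeff_eq_one_and_coeff_one_eq_order_of_subst_eq_mul h2 hred hFEk
  refine ⟨?_, ?_⟩
  · rwa [red, ← PowerSeries.coeff_zero_eq_constantCoeff_apply, PowerSeries.coeff_map,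
      PowerSeries.coeff_zero_eq_constantCoeff_apply] at hc0
  · rw [red, PowerSeries.coeff_map] at hc1
    rw [hc1, lam]

/-! ## §8 The two-fixed-points law (S64t) and the value of the multiplier at `−2` -/

/-- `g(−2) = g₀ − 2·g₁ + 4·r` for some `r ∈ ℤ₂` (`g ∈ ℤ₂⟦T⟧`). [folklore] -/
theorem exists_evalAt_negTwo_eq (g : PowerSeries ℤ_[2]) :
    ∃ r : ℤ_[2], BlindLever.evalAt (-2 : ℤ_[2]) g = constantCoeff g + (-2) * coeff 1 g + 4 * r := by
  set g₁ : PowerSeries ℤ_[2] := PowerSeries.mk fun n => coeff (n + 1) g with hg₁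
  set g₂ : PowerSeries ℤ_[2] := PowerSeries.mk fun n => coeff (n + 1) g₁ with hg₂
  have h1 : g = X * g₁ + C (constantCoeff g) := eq_X_mul_shift_add_const g
  have h2 : g₁ = X * g₂ + C (constantCoeff g₁) := eq_X_mul_shift_add_const g₁
  have hc1 : constantCoeff g₁ = coeff 1 g := by
    rw [← PowerSeries.coeff_zero_eq_constantCoeff_apply, hg₁, PowerSeries.coeff_mk]
  refine ⟨BlindLever.evalAt (-2 : ℤ_[2]) g₂, ?_⟩
  have e := congrArg (BlindLever.evalAtHom BlindLever.norm_neg_two_lt_one) h1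
  rw [h2, map_add, map_mul, map_add, map_mul, BlindLever.evalAtHom_apply,
    BlindLever.evalAtHom_apply, BlindLever.evalAtHom_apply, BlindLever.evalAtHom_apply,
    BlindLever.evalAtHom_apply, BlindLever.evalAt_X, BlindLever.evalAt_C, BlindLever.evalAt_C, hc1] at e
  rw [e]; ring

/-- Arithmetic in `ℤ/4`: `(−1)^a = (−1)^b − 2c` forces `a + b + c` even. [folklore] -/
theorem even_add_add_of_neg_one_pow_eq_zmod_four {a b c : ℕ}
    (h : (-1 : ZMod (2 ^ 2)) ^ a = (-1) ^ b - 2 * (c : ZMod (2 ^ 2))) : Even (a + b + c) := by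
  have hpow : ∀ x : ℕ, (-1 : ZMod (2 ^ 2)) ^ x = (-1) ^ (x % 2) := fun x => by
    conv_lhs => rw [← Nat.mod_add_div x 2, pow_add, pow_mul]
    norm_num
  have hc : (2 : ZMod (2 ^ 2)) * (c : ZMod (2 ^ 2)) = 2 * ((c % 2 : ℕ) : ZMod (2 ^ 2)) := by
    conv_lhs => rw [← Nat.mod_add_div c 2]
    have h4 : (2 : ZMod (2 ^ 2)) * 2 = 0 := by decide
    push_cast
    linear_combination ((c / 2 : ℕ) : ZMod (2 ^ 2)) * h4
  rw [hpow a, hpow b, hc] at h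
  rw [Nat.even_iff, Nat.add_mod, Nat.add_mod a]
  have ha := Nat.mod_lt a two_pos
  have hb := Nat.mod_lt b two_pos
  have hc' := Nat.mod_lt c two_pos
  interval_cases (a % 2) <;> interval_cases (b % 2) <;> interval_cases (c % 2) <;> revert h <;> decide

/-- **S64t · THE TWO-FIXED-POINTS LEMMA (root-free).** If `L(T^ι) = v·L` in `Λ = ℤ₂⟦T⟧`, `L` has order exactly `m` at
`T = 0` and exactly `n` at `T = −2`, then **`λ(L) + m + n` is even** — the zeros of `L` away from the two fixed points `0, −2`
of `ι` «pair off». No Weierstrass preparation and no roots in `ℂ₂` are used: with `v(0) = (−1)^m` (§5), `v(−2) = (−1)^n` (§6),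
`v(−2) ≡ v(0) − 2·v₁ (mod 4)` and `v₁ ≡ λ(L) (mod 2)` (§7) one gets `(−1)^n ≡ (−1)^m − 2λ (mod 4)`. At odd `p` the same
bookkeeping gives only `λ ≡ m`; `T = −2` lies in the open disc only at `p = 2` (Greenberg: «for `p = 2`, we would have another
possibility: `a = −2`»). Statement = the cell's planner-of-record support `TwoFixedPointLemma` (-imc g23, D-imc-64 Sketch66 §2b),
whose glue `lambdaTwoFixedPoints_of_twoFixedPointLemma` turns it into `LambdaTwoFixedPointsLawAtTwo` (K64λ) for Sprung's pair.
[cite: GreenbergLNM1716, §5 p. 181] -/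
theorem even_lam_add_orderAtZero_add_orderAtNegTwo {L v : PowerSeries ℤ_[2]} {m n : ℕ}
    (hFE : L.subst (invOnePlusSubOne : PowerSeries ℤ_[2]) = v * L) (hm : HasOrderAtZero L m) (hn : HasOrderAtNegTwo L n) : Even (lam L + m + n) := by
  have hL : L ≠ 0 := ne_zero_of_hasOrderAtZero hm
  have h0 : (-1 : ℤ_[2]) ^ m = constantCoeff v := neg_one_pow_eq_constantCoeff_of_hasOrderAtZero hFE hm
  have h2 : (-1 : ℤ_[2]) ^ n = BlindLever.evalAt (-2 : ℤ_[2]) v := neg_one_pow_eq_evalAt_negTwo_of_hasOrderAtNegTwo hFE hn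
  obtain ⟨-, h1⟩ := residue_constantCoeff_and_coeff_one hL hFE
  obtain ⟨r, hr⟩ := exists_evalAt_negTwo_eq v
  -- `v₁ = λ + 2 s`
  obtain ⟨s, hs⟩ : ∃ s : ℤ_[2], coeff 1 v - (lam L : ℤ_[2]) = 2 * s := by
    have h : IsLocalRing.residue ℤ_[2] (coeff 1 v - (lam L : ℤ_[2])) = 0 := by rw [map_sub, h1, map_natCast, sub_self]
    rw [IsLocalRing.residue_eq_zero_iff, PadicInt.maximalIdeal_eq_span_p, Ideal.mem_span_singleton] at h
    obtain ⟨s, hs⟩ := h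
    exact ⟨s, by rw [hs]; norm_num⟩
  -- pass to `ℤ/4`
  have key : (-1 : ℤ_[2]) ^ n = (-1) ^ m + (-2) * ((lam L : ℤ_[2]) + 2 * s) + 4 * r := by
    rw [h2, hr, ← h0]; linear_combination (-2 : ℤ_[2]) * hs
  have key4 := congrArg (PadicInt.toZModPow 2) key
  simp only [map_pow, map_neg, map_one, map_add, map_mul, map_natCast, map_ofNat] at key4
  have h4 : (4 : ZMod (2 ^ 2)) = 0 := by decide
  have h22 : (2 : ZMod (2 ^ 2)) * 2 = 0 := by decide
  have key' : (-1 : ZMod (2 ^ 2)) ^ n = (-1) ^ m - 2 * (lam L : ZMod (2 ^ 2)) := by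
    rw [key4]
    linear_combination (-(PadicInt.toZModPow 2 s)) * h22 + (PadicInt.toZModPow 2 r) * h4
  have := even_add_add_of_neg_one_pow_eq_zmod_four key'
  -- `n + m + λ` even
  obtain ⟨t, ht⟩ := this
  exact ⟨t, by omega⟩

/-- **The multiplier at the second fixed point: `v(−2) = (−1)^{λ(L)}·v(0)`** for every non-zero `L ∈ ℤ₂⟦T⟧` with
`L(T^ι) = v·L` — equivalently `(−1)^{λ(L)} = v(−2)/v(0)`; for the printed multiplier `v = w·(1+T)^c` this is the PARITY(2) law
`(−1)^λ = (−1)^{c} = χ₈(N)` of the tree (`even_firstUnitCoeff_iff_conductorNorm_mod_eight`), and for any «diagonal» functional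
equation it is the rigidity `(−1)^λ = (−1)^e` (-imc D-imc-65 `ExponentParityForcedAtTwo`). [cite: GreenbergLNM1716, §5 p. 181] -/
theorem evalAt_negTwo_eq_neg_one_pow_lam_mul_constantCoeff {L v : PowerSeries ℤ_[2]} (hL : L ≠ 0)
    (hFE : L.subst (invOnePlusSubOne : PowerSeries ℤ_[2]) = v * L) :
    BlindLever.evalAt (-2 : ℤ_[2]) v = (-1 : ℤ_[2]) ^ lam L * constantCoeff v := by
  obtain ⟨m, hm⟩ := exists_hasOrderAtZero hL
  obtain ⟨n, hn⟩ := exists_hasOrderAtNegTwo hL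
  rw [← neg_one_pow_eq_constantCoeff_of_hasOrderAtZero hFE hm, ← neg_one_pow_eq_evalAt_negTwo_of_hasOrderAtNegTwo hFE hn,
    ← pow_add]
  obtain ⟨t, ht⟩ := even_lam_add_orderAtZero_add_orderAtNegTwo hFE hm hn
  have : n + 2 * t = (lam L + m) + 2 * n := by omega
  calc (-1 : ℤ_[2]) ^ n = (-1) ^ n * ((-1) ^ 2) ^ t := by norm_num
    _ = (-1) ^ (n + 2 * t) := by rw [← pow_mul, ← pow_add]
    _ = (-1) ^ (lam L + m + 2 * n) := by rw [this]
    _ = (-1) ^ (lam L + m) := by rw [pow_add, pow_mul]; norm_num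

/-- The multiplier of a functional equation `L(T^ι) = v·L`, `L ≠ 0`, has `v(0) = ±1`; in particular it is a unit of `Λ`. [folklore] -/
theorem isUnit_of_subst_eq_mul {L v : PowerSeries ℤ_[2]} (hL : L ≠ 0) (hFE : L.subst (invOnePlusSubOne : PowerSeries ℤ_[2]) = v * L) : IsUnit v := by
  obtain ⟨m, hm⟩ := exists_hasOrderAtZero hL
  rw [PowerSeries.isUnit_iff_constantCoeff, ← neg_one_pow_eq_constantCoeff_of_hasOrderAtZero hFE hm]
  exact (isUnit_one.neg).pow m

/-- **Corollary (the road's shape): if `L(0) ≠ 0` then `λ(L) ≡ ord₋₂ L (mod 2)`**; so an ODD order at `T = −2` forces `λ(L)` odd,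
and `λ(L)` odd forces a zero at `T = −2`. [cite: GreenbergLNM1716, §5 p. 181] -/
theorem even_lam_add_orderAtNegTwo_of_constantCoeff_ne_zero {L v : PowerSeries ℤ_[2]} {n : ℕ}
    (hFE : L.subst (invOnePlusSubOne : PowerSeries ℤ_[2]) = v * L) (h0 : constantCoeff L ≠ 0) (hn : HasOrderAtNegTwo L n) : Even (lam L + n) := by
  have hm : HasOrderAtZero L 0 := by
    refine ⟨by rw [pow_zero]; exact one_dvd _, ?_⟩
    rw [zero_add, pow_one, PowerSeries.X_dvd_iff]
    exact h0
  simpa using even_lam_add_orderAtZero_add_orderAtNegTwo hFE hm hn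

/-- `μ(T + 2) = 0` and `pfree (T + 2) = T + 2`. [folklore] -/
theorem mu_X_add_C_two_and_pfree :
    mu (X + C (2 : ℤ_[2]) : PowerSeries ℤ_[2]) = 0 ∧ pfree (X + C (2 : ℤ_[2]) : PowerSeries ℤ_[2]) = X + C (2 : ℤ_[2]) := by
  refine mu_eq_and_pfree_eq (p := 2) (g₀ := X + C (2 : ℤ_[2])) (a := 0) ?_ (by simp)
  rw [red, map_residue_X_add_C_two]; exact X_ne_zero

/-- `λ(T + 2) = 1`. [folklore] -/
theorem lam_X_add_C_two : lam (X + C (2 : ℤ_[2]) : PowerSeries ℤ_[2]) = 1 := by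
  rw [lam, mu_X_add_C_two_and_pfree.2, red, map_residue_X_add_C_two, PowerSeries.order_X]; rfl

/-- `λ(pfree L) = λ(L)` and `μ(pfree L) = 0` for `L ≠ 0`. [folklore] -/
theorem mu_pfree_and_lam_pfree {L : PowerSeries ℤ_[2]} (hL : L ≠ 0) : mu (pfree L) = 0 ∧ lam (pfree L) = lam L := by
  obtain ⟨hmu, hpf⟩ := mu_eq_and_pfree_eq (p := 2) (g := pfree L) (g₀ := pfree L) (a := 0) (red_pfree_ne_zero hL) (by simp)
  exact ⟨hmu, by rw [lam, lam, hpf]⟩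

/-- **The `λ = 1` dichotomy at the second fixed point.** If `(T + 2) ∣ L ≠ 0` then `λ(L) = 1` iff the `2`-free part of `L` is
`(T + 2)·(unit)`; in that case `ord_{T=−2} L = 1` and the constant term of `L/2^{μ}` is exactly `2·(unit)`. So on the road (where
`ord₋₂` and `λ` are odd) **`λ ≥ 3` unless `L/2^μ = (T+2)·u`**, i.e. unless `ord₂ (L/2^μ)(0) = 1` — the crux memo's reading
«`ord₂ L₂(W,0) = 2·ord₂#Ẽ(𝔽₂) ∈ {2,4}` on the odd-`L/Ω` branch ⟹ `λ₂ ≥ 3`» (CHI8-TWIST-att-p5-g32 §2/§6, 19/19). [cite: Washington1997, §7.1] -/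
theorem lam_eq_one_iff_of_X_add_C_two_dvd {L : PowerSeries ℤ_[2]} (hL : L ≠ 0) (hdvd : (X + C (2 : ℤ_[2])) ∣ L) :
    lam L = 1 ↔ ∃ u : PowerSeries ℤ_[2], IsUnit u ∧ pfree L = (X + C (2 : ℤ_[2])) * u := by
  -- `(T+2) ∣ pfree L`
  have hfac := eq_C_pow_mu_mul_pfree (p := 2) L
  have h2μ : ((2 : ℕ) : ℤ_[2]) ^ mu L ≠ 0 := pow_ne_zero _ (by norm_num)
  have h0 : (X + C (2 : ℤ_[2])) ∣ pfree L := by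
    have h1 : (X + C (2 : ℤ_[2])) ^ 1 ∣ C (((2 : ℕ) : ℤ_[2]) ^ mu L) * pfree L := by rw [pow_one, ← hfac]; exact hdvd
    have := prime_X_add_C_two.pow_dvd_of_dvd_mul_left 1 (not_X_add_C_two_dvd_C h2μ) h1
    rwa [pow_one] at this
  obtain ⟨h, hh⟩ := h0
  have hpf0 : pfree L ≠ 0 := pfree_ne_zero hL
  have hh0 : h ≠ 0 := by rintro rfl; exact hpf0 (by rw [hh, mul_zero])
  have hX0 : (X + C (2 : ℤ_[2]) : PowerSeries ℤ_[2]) ≠ 0 := prime_X_add_C_two.ne_zero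
  obtain ⟨hmupf, hlampf⟩ := mu_pfree_and_lam_pfree hL
  have hmu : mu h = 0 := by
    have := mu_mul hX0 hh0
    rw [← hh, hmupf, mu_X_add_C_two_and_pfree.1] at this
    omega
  have hlam : lam L = 1 + lam h := by
    rw [← hlampf, hh, lam_mul hX0 hh0, lam_X_add_C_two]
  constructor
  · intro h1
    refine ⟨h, ?_, hh⟩
    rw [isUnit_iff_mu_eq_zero_and_lam_eq_zero]
    exact ⟨hh0, hmu, by omega⟩
  · rintro ⟨u, hu, hu'⟩
    have hu0 := (isUnit_iff_mu_eq_zero_and_lam_eq_zero u).mp hu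
    have : h = u := mul_left_cancel₀ hX0 (hh.symm.trans hu')
    rw [hlam, this, hu0.2.2]

/-- **`λ ≥ 3` on the road unless `L/2^μ = (T+2)·unit`**: if `L(T^ι) = v·L`, `L(0) ≠ 0`... more simply: if `λ(L)` is odd and
`(T+2) ∣ L`, then either `λ(L) ≥ 3` or the `2`-free part of `L` is `(T+2)` times a unit (constant term `2·unit`). [cite: Washington1997, §7.1] -/
theorem three_le_lam_or_of_odd_lam {L : PowerSeries ℤ_[2]} (hL : L ≠ 0) (hdvd : (X + C (2 : ℤ_[2])) ∣ L) (hodd : Odd (lam L)) :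
    3 ≤ lam L ∨ ∃ u : PowerSeries ℤ_[2], IsUnit u ∧ pfree L = (X + C (2 : ℤ_[2])) * u := by
  by_cases h1 : lam L = 1
  · exact Or.inr ((lam_eq_one_iff_of_X_add_C_two_dvd hL hdvd).mp h1)
  · left
    obtain ⟨k, hk⟩ := hodd
    omega

/-- **S64t in the binder shape typed by the planner-of-record** (`TwoFixedPointLemma` of D-imc-64 Sketch66, verbatim up to the
ambient namespace; the hypothesis `IsUnit v` is not needed). [cite: GreenbergLNM1716, §5 p. 181] -/
theorem twoFixedPointLemma :
    ∀ (L v : IwasawaAlgebra 2) (m n : ℕ), IsUnit v →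
      L.subst (Literature.Barriers.BirchSwinnertonDyer.invOnePlusSubOne : PowerSeries ℤ_[2]) = v * L →
      HasOrderAtZero L m → HasOrderAtNegTwo L n → Even (lam L + m + n) :=
  fun _ _ _ _ _ hFE hm hn => even_lam_add_orderAtZero_add_orderAtNegTwo hFE hm hn


end Summit.BirchSwinnertonDyer.BirchSwinnertonDyer.Theorems.AlignedTransportAtTwoTwoFixedPoints

end
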